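import Literature.NumberTheory.EllipticCurves.Rank1Residual.Typed.KimCertificate
import Literature.NumberTheory.EllipticCurves.Rank1Residual.Typed.X6
import Literature.NumberTheory.EllipticCurves.Rank1Residual.Typed.X7
import HarnessLib

/-!
# Classes X7 (both ranks) and X6 (rank `1`) at a good supersingular `p ≥ 5`: `BSD(E,p)` per pair from
# ONE unit Kurihara number (Kim, Amer. J. Math. 2026, Thm. 1.8 (6)) — the supersingular-family readings
# of the cell's class-agnostic consumers (cell `b2b-bsdres`, prover A = unit `b2b-bsdres-x10b`, gen 6;
# X7 joint with prover B = unit `b2b-bsdres-additive-p3`)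

HONEST FRAMING (run/shared/lean/b2b/bsd-rank1-residual/, verbatim in every file): the goal of the
cell is to DELETE the COMBINATION-SHAPED residual classes of the Birch–Swinnerton-Dyer formula for
ALL analytic-rank `≤ 1` elliptic curves over `ℚ` — "full BSD formula for every rank `≤ 1` curve in
class `C`" assembled STRICTLY from published theorems — so that the rank-`≤ 1` remainder becomes
exactly the CONSTRUCTION-SHAPED classes, which are TYPED (missing-input `Prop`s), NOT attempted.
This is not "finishing BSD". THEOREMS ONLY; per pair; NOT a class theorem; X6 and X7 stay
CONSTRUCTION-SHAPED; nothing is booked here (the lane books pairs: two engines + referee).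

## What this file does (X6-ROUTE.md §6, X7-KURIHARA.md, HOME/b2b-bsdres-x10b/)

`Supersingular/X6KuriharaRoute.lean` (p209988) read the cell's class-agnostic Kurihara consumers
(`Typed/KimCertificate.lean`, prover x11a: C.-H. Kim, Amer. J. Math. 148 (2026) Thm. 1.8 (6) + Cor. 1.6,
named facts `Kim2022_rankZero_padicValRat_sha_of_kuriharaNumber_ne_zero` /
`Kim2022_rankOne_card_sha_eq_one_of_kuriharaNumber_ne_zero`, PUBLISHED) on class X6 in analytic rank `0`.
Kim's theorem has NO hypothesis on the reduction TYPE at a good `p` and NO square-free-conductor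
hypothesis, so the same consumers read verbatim on class **X7** (`ss(p) ∧ ¬sst`: good supersingular at
`p`, `E` not semistable) — with ONE difference: on X7 the surjectivity of `ρ̄_{E,p}` is NOT automatic
(Serre's Prop. 21 uses semistability; the census has X7 pairs with image `5Nn`), so it is a displayed
per-pair hypothesis `Surj W p` (Cremona's galrep datum, two sources in the census). Irreducibility IS
automatic (`ClassX7.irr`, Serre Prop. 12), hence `p ∤ #E(ℚ)_tors`; the period transfer
`Ω(W) = u·Ω⁺_f`, `|u|_p = 1` is the tree's named fact `realPeriodRat_eq_unit_mul_plusPeriod`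
(Greenberg–Vatsal 2000 Rem. 3.4 + Mazur 1978 Cor. 4.1 + Edixhoven; good `p ≥ 5`, `E[p]` irreducible —
no semistability asked).

* `X7.bsdp_of_kim_rankZero_of_kuriharaNumber_ne_zero` — X7 ∧ `r_an = 0` ∧ `p ≥ 5` ∧ surj(p) ∧
  `p ∤ ∏ c_ℓ` + certificate `(n, ψ, δ̃_n ≢ 0)` at a Kolyvagin level with cyclic reductions ⇒ `BSDp W p`.
* `X7.bsdp_of_kim_rankOne_of_kuriharaNumber_ne_zero` — X7 ∧ `r_an = 1` ∧ `p ≥ 5` ∧ surj(p) ∧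
  `#Ш_an = q`, `ord_p q = 0` + certificate at a PRIME Kolyvagin level `ℓ` ⇒ `BSDp W p`.
* `X6.bsdp_of_kim_rankOne_of_kuriharaNumber_ne_zero` — the same on X6 ∧ `r_an = 1` (surj automatic,
  `ClassX6.surj`): a second, flag-free per-pair route beside the class's rank-one closure by
  Jetchev–Skinner–Wan 2017 Thm. 1.2.1 (`X6.bsdp_of_analyticRank_eq_one'`, which carries the cell's flag
  `JSW-ss`: JSW's supersingular case imports the withdrawn preprint [W]).

Inputs, all PUBLISHED and by name: Kim Thm. 1.8 (6) (`hKim`), the period fact (`hϖ`), GZK (`hGZK`),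
modularity (`hmod`, only to read `r_an` as (non-)vanishing of `L(E,1)`). No signed main conjecture, no
BSTW/CCSS binder, no Heegner index.

Where it bites (hyp GEN 18 census KIM-SS, `HOME/b2b-bsdres-hyp/hyp/kimss/KIM-SS.md`, CORE of record,
good `p ≥ 5`): X7 ∧ `r = 0`: 6516b1@5 (`n = 461·911`, `δ̃ ≡ 4`), 10304f1@5 (`31·401`, `≡ 4`),
15138f1@5 (`71·211`, `≡ 2`), 17816c1@7 (`127·631`, `≡ 3`) — all with `#Ш_an = p²`, `p ∤ ∏c_ℓ`;
X7 ∧ `r = 1` (`#Ш_an = 1`): 9348b1@5 (`ℓ = 101`), 10956e1@5 (`41`), 11256b1@5 (`11`), 11592m1@5 (`31`),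
12432bn1@5 (`61`), 14040o1@7 (`449`), 14616a1@5 (`311`), 16074c1@5 (`131`). Every one of these twelve
levels is TWO-ENGINE (kurihara lane impl 1 = the tree's fleet records `KuriharaCertificates.cert_<label>`;
lane impl 2 UNMODIFIED, hyp kit jobs j095297/j095299/j095301: `δ̃ mod p` identical, symbol tables
byte-identical), every level prime Kolyvagin with CYCLIC `p`-part on two engines (hyp H1 exact division
polynomials = PARI `ellgroup` j095303); records `Supersingular/X7KuriharaRecords.lean`. Not served: the two
X7 rank-`0` pairs with image `5Nn` (6372a1@5, 18324a1@5: `Surj` fails — no Kurihara level exists there by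
the tree's no-go `KolyvaginPrimeSmallImage`, p216591), 13456j1@5 (only zeros at the four levels tried),
and the 13 X7 rank-`1` pairs with `p ∣ ∏c_ℓ` (a unit `δ̃_n mod p` is impossible there, Kim Conj. 1.10;
the level-two route `bsdp_of_kim_rankOne_levelTwo_of_casselsTate` is the tree's instrument for them).

References: Kim 2026 [Kim2022StructureSelmer] Thm. 1.8 (6), Cor. 1.6, §1.3.5; Greenberg–Vatsal 2000
Rem. 3.4 [GreenbergVatsal2000]; Mazur 1978 Cor. 4.1 [Mazur1978]; Serre 1972 Props. 12, 21
[Serre1972]; Miller 2011 Def. 1.1 [Miller2011LMS]; Jetchev–Skinner–Wan 2017 Thm. 1.2.1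
[JetchevSkinnerWan2017].
-/

set_option autoImplicit false

noncomputable section

open scoped Classical MatrixGroups ModularForm

open CongruenceSubgroup WeierstrassCurve Literature.NumberTheory.EllipticCurves
  Literature.NumberTheory.EllipticCurves.ModularForms
  Literature.NumberTheory.EllipticCurves.Rank1Residual
  Literature.NumberTheory.EllipticCurves.Rank1Residual.Typed

namespace Summit.BirchSwinnertonDyer.Rank1Residual.Supersingular

variable (W : WeierstrassCurve ℚ) [W.IsElliptic] [W.IsGloballyMinimal] (p : ℕ) [Fact p.Prime]

/-- On X7 at an odd `p`, `p ∤ #E(ℚ)_tors`: `E[p]` is irreducible (`ClassX7.irr`, Serre Prop. 12), so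
`E(ℚ)[p] = 0` (`padicValNat_torsionOrder_eq_zero_of_irreducible`). [cite: Serre1972, §1.11 Prop. 12] -/
theorem ClassX7.not_dvd_torsionOrder (hp : p ≠ 2) (hX : ClassX7 W p) : ¬ p ∣ W.torsionOrder := by
  intro hdvd
  have h0 := padicValNat_torsionOrder_eq_zero_of_irreducible W p (ClassX7.irr W p hp hX)
  have hpos : 0 < W.torsionOrder := W.torsionOrder_pos_holds
  have : 1 ≤ padicValNat p W.torsionOrder := one_le_padicValNat_of_dvd hpos.ne' hdvd
  omega

/-- **X7 ∧ `r_an = 0` ∧ `p ≥ 5` ∧ surj(p): `BSD(E,p)` from PUBLISHED theorems plus ONE Kurihara-number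
certificate.** On class X7 (good supersingular at `p`, `E` not semistable) at a prime `p ≥ 5` in analytic
rank `0`, with `ρ̄_{E,p}` onto (`hsurj`, per pair — NOT automatic on X7) and `p ∤ ∏_ℓ c_ℓ`: Kim 2026
Thm. 1.8 (6) (`hKim`), the good-prime period transfer (`hϖ`, Greenberg–Vatsal Rem. 3.4 + Mazur
Cor. 4.1), GZK (`hGZK`) and modularity (`hmod`), together with the per-pair CERTIFICATE — a Kolyvagin
level `n ∈ 𝒩_1` (`ℓ ∤ Np`, `ℓ ≡ 1`, `a_ℓ ≡ ℓ + 1 (mod p)`) with cyclic `p`-parts `#Ẽ(𝔽_ℓ)[p] ≤ p`,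
surjective discrete logarithms `ψ_ℓ`, and `kuriharaNumber f p n ψ ≠ 0` (`δ̃_n ≢ 0 (mod p)`) — give
Miller's `BSDp W p`. Good reduction at `p` (class) and `p ∤ #E(ℚ)_tors` (`ClassX7.irr`) are automatic.
Per pair; NOT a class theorem; X7 stays CONSTRUCTION-SHAPED.
[cite: Kim2022StructureSelmer, Thm. 1.9 (6) (PDF p. 8), Cor. 1.6] [cite: GreenbergVatsal2000, §3, Remark 3.4]
[cite: Serre1972, §1.11 Prop. 12] [cite: Miller2011LMS, Def. 1.1] -/
theorem X7.bsdp_of_kim_rankZero_of_kuriharaNumber_ne_zero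
    (hKim : Kim2022_rankZero_padicValRat_sha_of_kuriharaNumber_ne_zero)
    (hϖ : realPeriodRat_eq_unit_mul_plusPeriod)
    (hGZK : rank_eq_analyticRank_of_analyticRank_le_one) (hmod : hasEntireLFunction_rat)
    (hp : 5 ≤ p) (hX : ClassX7 W p) (hsurj : Surj W p) (hr : W.analyticRank = 0)
    (htam : ¬ p ∣ W.tamagawaProduct)
    {N : ℕ} [NeZero N] (f : CuspForm (Gamma0 N) 2) (hf : IsNewformOf W f)
    (n : ℕ) [NeZero n] (hn : Kato.IsKolyvaginProduct W p 1 n)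
    (hcyc : ∀ (ℓ : ℕ) [Fact ℓ.Prime], ℓ ∣ n →
      Nat.card {P : ((WeierstrassCurve.integralModelInt W).map
          (Int.castRingHom (ZMod ℓ))).toAffine.Point // p • P = 0} ≤ p)
    (ψ : (ℓ : ℕ) → (ZMod ℓ)ˣ →* Multiplicative (ZMod (p ^ 1)))
    (hψ : ∀ ℓ ∈ n.primeFactors, Function.Surjective (ψ ℓ))
    (hδ : kuriharaNumber f (p ^ 1) n ψ ≠ 0) : BSDp W p := by
  have hp2 : p ≠ 2 := by omega
  have hirr : W.HasIrreducibleModPGaloisRep p := ClassX7.irr W p hp2 hX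
  exact Typed.bsdp_of_kim_rankZero_of_kuriharaNumber_ne_zero W p hKim hGZK hp (Or.inl hX.1.1)
    hsurj ((W.analyticRank_eq_zero_iff_holds (hmod W)).mp hr) htam
    (ClassX7.not_dvd_torsionOrder W p hp2 hX) f hf (hϖ W p hp hX.1.1 hirr f hf) n hn hcyc ψ hψ hδ

/-- **X7 ∧ `r_an = 1` ∧ `p ≥ 5` ∧ surj(p) ∧ `ord_p #Ш_an = 0`: `BSD(E,p)` from PUBLISHED theorems plus
ONE Kurihara-number certificate at a PRIME level.** On class X7 at `p ≥ 5` in analytic rank `1`, with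
`ρ̄_{E,p}` onto (`hsurj`, per pair) and the lane's exact `#Ш_an = q`, `ord_p q = 0` (`hq`, `hv`): Kim 2026
Thm. 1.8 (6) + Cor. 1.6 (`hKim`: `Ш(E/ℚ)[p^∞] = 0` from `δ̃_ℓ ≢ 0 (mod p)` at a Kolyvagin PRIME `ℓ` with
cyclic `p`-part and surjective `ψ_ℓ`), the period transfer (`hϖ`), GZK (`hGZK`), modularity (`hmod`, to
read `r_an = 1` as `L(E,1) = 0`) ⇒ `BSDp W p` (`Typed.bsdp_of_kim_rankOne_of_kuriharaNumber_ne_zero`: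
unit `#Ш_an` + `Ш[p] = 0`). No `p ∤ ∏c_ℓ` hypothesis is displayed (a unit `δ̃_ℓ` forces it, Kim
Conj. 1.10 / Thm. 1.8; the census rows served all have `p ∤ ∏c_ℓ`). Per pair; NOT a class theorem.
[cite: Kim2022StructureSelmer, Thm. 1.9 (6) (PDF p. 8), Cor. 1.6] [cite: GreenbergVatsal2000, §3, Remark 3.4]
[cite: Serre1972, §1.11 Prop. 12] [cite: Miller2011LMS, Def. 1.1] -/
theorem X7.bsdp_of_kim_rankOne_of_kuriharaNumber_ne_zero
    (hKim : Kim2022_rankOne_card_sha_eq_one_of_kuriharaNumber_ne_zero)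
    (hϖ : realPeriodRat_eq_unit_mul_plusPeriod)
    (hGZK : rank_eq_analyticRank_of_analyticRank_le_one) (hmod : hasEntireLFunction_rat)
    (hp : 5 ≤ p) (hX : ClassX7 W p) (hsurj : Surj W p) (hr : W.analyticRank = 1)
    {q : ℚ} (hq : shaAn W = (q : ℂ)) (hv : padicValRat p q = 0)
    {N : ℕ} [NeZero N] (f : CuspForm (Gamma0 N) 2) (hf : IsNewformOf W f)
    (ℓ : ℕ) [Fact ℓ.Prime] (hℓ : Kato.IsKolyvaginPrime W p 1 ℓ)
    (hcyc : Nat.card {P : ((WeierstrassCurve.integralModelInt W).map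
        (Int.castRingHom (ZMod ℓ))).toAffine.Point // p • P = 0} ≤ p)
    (ψ : (ℓ' : ℕ) → (ZMod ℓ')ˣ →* Multiplicative (ZMod (p ^ 1)))
    (hψ : Function.Surjective (ψ ℓ)) (hδ : kuriharaNumber f (p ^ 1) ℓ ψ ≠ 0) : BSDp W p := by
  have hp2 : p ≠ 2 := by omega
  have hirr : W.HasIrreducibleModPGaloisRep p := ClassX7.irr W p hp2 hX
  have hL : W.entireLFunction 1 = 0 := by
    by_contra hne
    have h0 := (W.analyticRank_eq_zero_iff_holds (hmod W)).mpr hne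
    omega
  exact Typed.bsdp_of_kim_rankOne_of_kuriharaNumber_ne_zero W p hKim hGZK hp (Or.inl hX.1.1) hsurj hL
    hr hq hv f hf (hϖ W p hp hX.1.1 hirr f hf) ℓ hℓ hcyc ψ hψ hδ

/-- **X6 ∧ `r_an = 1` ∧ `p ≥ 5` ∧ `ord_p #Ш_an = 0`: `BSD(E,p)` from PUBLISHED theorems plus ONE
Kurihara-number certificate at a PRIME level** — the rank-one twin of
`X6.bsdp_of_kim_rankZero_of_kuriharaNumber_ne_zero` (p209988). On class X6 (good supersingular,
semistable, `p ≥ 5 ∨ a_3 = 0`) at `p ≥ 5`: surjectivity of `ρ̄_{E,p}` (`ClassX6.surj`, Serre Props. 12 +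
21 i)) and irreducibility are automatic; inputs Kim 2026 Thm. 1.8 (6) + Cor. 1.6 (`hKim`), the period
transfer (`hϖ`), GZK (`hGZK`), modularity (`hmod`); per pair the lane's exact `#Ш_an = q` with
`ord_p q = 0`, the newform `f`, a Kolyvagin prime `ℓ` with cyclic `p`-part, `ψ`, `δ̃_ℓ ≢ 0 (mod p)`.
A flag-free per-pair route beside the class's rank-one closure `X6.bsdp_of_analyticRank_eq_one'`
(Jetchev–Skinner–Wan 2017 Thm. 1.2.1, cell flag `JSW-ss`). Per pair; NOT a class theorem.
[cite: Kim2022StructureSelmer, Thm. 1.9 (6) (PDF p. 8), Cor. 1.6] [cite: GreenbergVatsal2000, §3, Remark 3.4]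
[cite: Serre1972, §5.4 Prop. 21 i)] [cite: Miller2011LMS, Def. 1.1] -/
theorem X6.bsdp_of_kim_rankOne_of_kuriharaNumber_ne_zero
    (hKim : Kim2022_rankOne_card_sha_eq_one_of_kuriharaNumber_ne_zero)
    (hϖ : realPeriodRat_eq_unit_mul_plusPeriod)
    (hGZK : rank_eq_analyticRank_of_analyticRank_le_one) (hmod : hasEntireLFunction_rat)
    (hp : 5 ≤ p) (hX : ClassX6 W p) (hr : W.analyticRank = 1)
    {q : ℚ} (hq : shaAn W = (q : ℂ)) (hv : padicValRat p q = 0)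
    {N : ℕ} [NeZero N] (f : CuspForm (Gamma0 N) 2) (hf : IsNewformOf W f)
    (ℓ : ℕ) [Fact ℓ.Prime] (hℓ : Kato.IsKolyvaginPrime W p 1 ℓ)
    (hcyc : Nat.card {P : ((WeierstrassCurve.integralModelInt W).map
        (Int.castRingHom (ZMod ℓ))).toAffine.Point // p • P = 0} ≤ p)
    (ψ : (ℓ' : ℕ) → (ZMod ℓ')ˣ →* Multiplicative (ZMod (p ^ 1)))
    (hψ : Function.Surjective (ψ ℓ)) (hδ : kuriharaNumber f (p ^ 1) ℓ ψ ≠ 0) : BSDp W p := by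
  have hp2 : p ≠ 2 := by omega
  have hirr : W.HasIrreducibleModPGaloisRep p := ClassX6.irr W p hp2 hX
  have hL : W.entireLFunction 1 = 0 := by
    by_contra hne
    have h0 := (W.analyticRank_eq_zero_iff_holds (hmod W)).mpr hne
    omega
  exact Typed.bsdp_of_kim_rankOne_of_kuriharaNumber_ne_zero W p hKim hGZK hp (Or.inl hX.1.1)
    (ClassX6.surj W p hp2 hX) hL hr hq hv f hf (hϖ W p hp hX.1.1 hirr f hf) ℓ hℓ hcyc ψ hψ hδ

/-! ### Appendix (gen 6, same day): the typed X7 currency discharged per pair by the Kurihara certificate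

`Typed/X7.lean` types the X7 residue as `X7.MissingInputAt W p` (rank `0`, odd `p`, Borel-or-surjective:
the LOWER bound; otherwise the whole `p`-part). At a pair carrying a Kurihara certificate it holds
outright, through `BSD(E,p)` itself (`missingPPartAt_of_bsdp`, `lower_and_upper_of_missingPPartAt`) —
bookkeeping for the Partition / hyp tables, exactly as `X7.missingInputAt_of_matarNekovar_of_not_dvd_index`
(`HeegnerIndexRoute.lean`) and `X11RankZero.missingInputAt_of_kim_of_kuriharaNumber_ne_zero`
(`Typed/KimCertificate.lean`). Per pair; the class stays typed. -/

/-- **X7 ∧ `r_an = 0` ∧ `p ≥ 5` ∧ surj(p) ∧ `p ∤ ∏c_ℓ` + ONE unit Kurihara number: the typed residue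
`X7.MissingInputAt W p` holds at the pair** (via `BSD(E,p)`, `X7.bsdp_of_kim_rankZero_of_kuriharaNumber_ne_zero`).
Bookkeeping only. [cite: Kim2022StructureSelmer, Thm. 1.9 (6) (PDF p. 8), Cor. 1.6] [cite: Miller2011LMS, Def. 1.1] -/
theorem X7.missingInputAt_of_kim_rankZero_of_kuriharaNumber_ne_zero
    (hKim : Kim2022_rankZero_padicValRat_sha_of_kuriharaNumber_ne_zero)
    (hϖ : realPeriodRat_eq_unit_mul_plusPeriod)
    (hGZK : rank_eq_analyticRank_of_analyticRank_le_one) (hmod : hasEntireLFunction_rat)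
    (hp : 5 ≤ p) (hX : ClassX7 W p) (hsurj : Surj W p) (hr : W.analyticRank = 0)
    (htam : ¬ p ∣ W.tamagawaProduct)
    {N : ℕ} [NeZero N] (f : CuspForm (Gamma0 N) 2) (hf : IsNewformOf W f)
    (n : ℕ) [NeZero n] (hn : Kato.IsKolyvaginProduct W p 1 n)
    (hcyc : ∀ (ℓ : ℕ) [Fact ℓ.Prime], ℓ ∣ n →
      Nat.card {P : ((WeierstrassCurve.integralModelInt W).map
          (Int.castRingHom (ZMod ℓ))).toAffine.Point // p • P = 0} ≤ p)
    (ψ : (ℓ : ℕ) → (ZMod ℓ)ˣ →* Multiplicative (ZMod (p ^ 1)))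
    (hψ : ∀ ℓ ∈ n.primeFactors, Function.Surjective (ψ ℓ))
    (hδ : kuriharaNumber f (p ^ 1) n ψ ≠ 0) : X7.MissingInputAt W p := by
  obtain ⟨-, hfin⟩ := hGZK W (by rw [hr]; exact zero_le_one)
  haveI : Finite W.sha := hfin
  have hB := X7.bsdp_of_kim_rankZero_of_kuriharaNumber_ne_zero W p hKim hϖ hGZK hmod hp hX hsurj hr htam
    f hf n hn hcyc ψ hψ hδ
  have hPP := missingPPartAt_of_bsdp W p hB
  exact ⟨fun _ _ _ ↦ (lower_and_upper_of_missingPPartAt W p hPP).1, fun _ ↦ hPP⟩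

/-- **X7 ∧ `r_an = 1` ∧ `p ≥ 5` ∧ surj(p) ∧ `ord_p #Ш_an = 0` + ONE unit Kurihara number at a prime
level: `X7.MissingInputAt W p` holds at the pair** (via `X7.bsdp_of_kim_rankOne_of_kuriharaNumber_ne_zero`).
Bookkeeping only. [cite: Kim2022StructureSelmer, Thm. 1.9 (6) (PDF p. 8), Cor. 1.6] [cite: Miller2011LMS, Def. 1.1] -/
theorem X7.missingInputAt_of_kim_rankOne_of_kuriharaNumber_ne_zero
    (hKim : Kim2022_rankOne_card_sha_eq_one_of_kuriharaNumber_ne_zero)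
    (hϖ : realPeriodRat_eq_unit_mul_plusPeriod)
    (hGZK : rank_eq_analyticRank_of_analyticRank_le_one) (hmod : hasEntireLFunction_rat)
    (hp : 5 ≤ p) (hX : ClassX7 W p) (hsurj : Surj W p) (hr : W.analyticRank = 1)
    {q : ℚ} (hq : shaAn W = (q : ℂ)) (hv : padicValRat p q = 0)
    {N : ℕ} [NeZero N] (f : CuspForm (Gamma0 N) 2) (hf : IsNewformOf W f)
    (ℓ : ℕ) [Fact ℓ.Prime] (hℓ : Kato.IsKolyvaginPrime W p 1 ℓ)
    (hcyc : Nat.card {P : ((WeierstrassCurve.integralModelInt W).map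
        (Int.castRingHom (ZMod ℓ))).toAffine.Point // p • P = 0} ≤ p)
    (ψ : (ℓ' : ℕ) → (ZMod ℓ')ˣ →* Multiplicative (ZMod (p ^ 1)))
    (hψ : Function.Surjective (ψ ℓ)) (hδ : kuriharaNumber f (p ^ 1) ℓ ψ ≠ 0) :
    X7.MissingInputAt W p := by
  obtain ⟨-, hfin⟩ := hGZK W hr.le
  haveI : Finite W.sha := hfin
  have hB := X7.bsdp_of_kim_rankOne_of_kuriharaNumber_ne_zero W p hKim hϖ hGZK hmod hp hX hsurj hr hq hv
    f hf ℓ hℓ hcyc ψ hψ hδ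
  have hPP := missingPPartAt_of_bsdp W p hB
  exact ⟨fun _ _ _ ↦ (lower_and_upper_of_missingPPartAt W p hPP).1, fun _ ↦ hPP⟩

end Summit.BirchSwinnertonDyer.Rank1Residual.Supersingular

end
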